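import Summits.AtomisticToContinuum.HydrodynamicLimit.Theorems.CollisionIsometryCLTCollisionalTransferLocalityRhsSupOfConstLLN
import Summits.AtomisticToContinuum.HydrodynamicLimit.Theorems.CollisionIsometryCLTCollisionalTransferLocalityKfunAConeConst
import Summits.AtomisticToContinuum.HydrodynamicLimit.Theorems.CollisionIsometryCLTCollisionalTransferLocalityWeightedKineticRelaxationDilute
import Summits.AtomisticToContinuum.HydrodynamicLimit.Theorems.CollisionIsometryCLTCollisionalTransferLocalityConeLLNConst
import HarnessLib

/-!
# [Vχ0C] The energy value functional on CONE-kernel block fields vanishes at global equilibrium,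
# uniformly in `τ ≤ t` (stub `stub_valueChi_cone_const`, line `hemisphere-affine-slaving`,
# crux `CollisionalTransferLocality`, stmt-AtomisticToContinuum-9518)

Supporting file (`--supports stmt-AtomisticToContinuum-9518`) proving the registered stub [Vχ0C] VERBATIM: for
`θ > 0` there is `σ₀ > 0` such that for `0 < σ < σ₀`, every flow family `Φ`, `t > 0`, a FIXED cone radius
`0 < r < 1/4`, a scalar test `χ` smooth on `[0, t]` and `δ > 0`, under `G_N = localGibbsLaw σ 1 0 θ N (Φ N)`:
`G_N {∃ τ ∈ [0, t], δ < |Rhs[b_r](0, χ)(τ) + Kfun[b_r](0, χ)(τ)|} → 0`, `b_r := fun _ y => coneKernel r y 0`.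

Proof. One union bound over four bad events of vanishing probability, on good data with integrable paths:
* Rhs (`∫₀^τ∫ₓ (∇χ·ū) p_c(ρ̄, θ̄)`, `div 0 = 0`): the cut-off slice process `X` of the landed [R0]
  `stub_rhsSup_of_constLLN` (…RhsSupOfConstLLN; `sup_τ |Rhs(τ)| ≤ ∫₀ᵗ X_s ds`, stationarity, deterministic smallness
  per slice `abs_integral_eulerW_pcoll_le_of_lln`, `L²` envelope `abs_integral_eulerW_pcoll_le_velAvg`, time
  integration in probability `tendsto_measure_setIntegral_of_forall`), fed with the cone LLN at constant profiles
  (`stub_coneLLNConst`) and the dilute event `{ρ̄σ³ > η₁}` inside the mollified-ceiling event `{ρ_r > 2}`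
  (`stub_mollifiedCeilingConst`, `ConeValue.rhoB_cone`, `2σ³ ≤ η₁`; radii as in c10's [R0C] `stub_rhsA_cone_const`);
* Kfun: the pathwise bound of the landed [C]° (`abs_Kfun_dilute_le`, uniform in `τ ≤ t`, any continuous bounded
  kernel of mass one) off the dilute event, the energy event ([E] `stub_energyAllTimes`) and the kinetic-closure
  event `∫₀ᵗ∫ₓ (Σ D̄² + |q|²) > δ'`, whose probability tends to `0` at equilibrium for the FIXED kernel bound
  `3/(π r³)` (`ValueChiConeConst.tendsto_measure_kineticClosure`: `‖∫ f‖ₑ ≤ ∫⁻ ‖f‖ₑ`, Markov + Tonelli +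
  stationarity `KfunAConeConst.measure_le_of_stationary`, Gaussian statics `KfunAConeConst.tendsto_lintegral_kinetic`
  of c10's [K0C]); `sup_τ |Rhs| ≤ δ/2`, `sup_τ |Kfun| ≤ δ/3` off the events.
Folklore; no definitions, no named facts.
-/

namespace Summit.AtomisticToContinuum.HydrodynamicLimit.Theorems.HemisphereAffineSlaving

open scoped BigOperators Topology Classical ENNReal InnerProductSpace
open Filter Set Function MeasureTheory

noncomputable section

open Literature.MathematicalPhysics.KineticTheory (T3 V3)
open Literature.Analysis.FunctionSpaces
open Literature.Analysis.FluidPDE (configEnergy)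
open Literature.MathematicalPhysics.KineticTheory (localGibbsLaw isProbabilityMeasure_localGibbsLaw gaussMeasure
  hsCompressibility coneKernel mollDensity coneKernel_mem_Icc integral_coneKernel)

namespace ValueChiConeConst

/-- **The kinetic closure at global equilibrium for a bounded kernel family, in probability.** Under the
homogeneous local Gibbs law (`σ ≤ 1/2`, `θ > 0`, any flow family), for continuous kernels `0 ≤ φ_N ≤ M` of mass
one with `M` FIXED, every `t` and `δ > 0`: `G_N {δ < ∫₀ᵗ∫ₓ (Σ_jk D̄_jk² + |q|²)(Φ_s z, x)} → 0`
(`ofReal δ ≤ ‖∫∫F‖ₑ ≤ ∫⁻_{[0,t]} ∫⁻ₓ ofReal F` on the event; Markov, Tonelli and stationarity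
`KfunAConeConst.measure_le_of_stationary`; the statics `KfunAConeConst.tendsto_lintegral_kinetic`). [folklore] -/
theorem tendsto_measure_kineticClosure {σ θ : ℝ} (hθ : 0 < θ) (hσ2 : σ ≤ 1 / 2) (Φ : Flows σ)
    {φ : ℕ → T3 → ℝ} (hφc : ∀ N, Continuous (φ N)) (hφ0 : ∀ N y, 0 ≤ φ N y) {M : ℝ}
    (hφM : ∀ N y, φ N y ≤ M) (hφ1 : ∀ N, ∫ y, φ N y = 1) (t : ℝ) {δ : ℝ} (hδ : 0 < δ) :
    Tendsto (fun N : ℕ => localGibbsLaw σ (fun _ => 1) (fun _ => 0) (fun _ => θ) N (Φ N)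
      {z | δ < ∫ s in Icc 0 t, ∫ x, ((∑ j, ∑ k, Dst φ N ((Φ N).flow s z) x j k ^ 2) +
        ‖qfl φ N ((Φ N).flow s z) x‖ ^ 2)}) atTop (𝓝 0) := by
  set P : (N : ℕ) → Measure (Cfg N) :=
    fun N => localGibbsLaw σ (fun _ => 1) (fun _ => 0) (fun _ => θ) N (Φ N) with hP
  set F : (N : ℕ) → Cfg N → T3 → ℝ := fun N w x =>
    (∑ j, ∑ k, Dst φ N w x j k ^ 2) + ‖qfl φ N w x‖ ^ 2 with hF
  have hF0 : ∀ N w x, 0 ≤ F N w x := fun N w x => by positivity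
  set G : (N : ℕ) → Cfg N → ℝ≥0∞ := fun N w => ∫⁻ x, ENNReal.ofReal (F N w x) with hG
  have hGm : ∀ N, Measurable (G N) := fun N =>
    (measurable_kineticIntegrand φ N (hφc N)).ennreal_ofReal.lintegral_prod_right'
  have hc : ENNReal.ofReal δ ≠ 0 := (ENNReal.ofReal_pos.2 hδ).ne'
  haveI hPr : ∀ N, IsProbabilityMeasure (P N) := fun N =>
    isProbabilityMeasure_localGibbsLaw (a₀ := fun _ => 1) (θ₀ := fun _ => θ) (u₀ := fun _ => 0)
      continuous_const continuous_const continuous_const (fun _ => one_pos) (fun _ => hθ) hσ2 N (Φ N)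
  change Tendsto (fun N : ℕ => P N {z | δ < ∫ s in Icc 0 t, ∫ x, F N ((Φ N).flow s z) x}) atTop (𝓝 0)
  have hbound : ∀ N : ℕ, P N {z | δ < ∫ s in Icc 0 t, ∫ x, F N ((Φ N).flow s z) x} ≤
      P N ∅ + 1 * (ENNReal.ofReal t * ∫⁻ z, G N z ∂(P N)) / ENNReal.ofReal δ := by
    intro N
    refine KfunAConeConst.measure_le_of_stationary Φ N (P N) (localGibbsLaw_compl_good' (Φ N))
      (fun s g hg => lintegral_comp_flow_localGibbsLaw_const σ 1 θ 0 N (Φ N) s hg) (G N) (hGm N) t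
      hc ENNReal.ofReal_ne_top fun z _ hzδ _ => ?_
    rw [one_mul]
    have hI0 : ∀ s, 0 ≤ ∫ x, F N ((Φ N).flow s z) x := fun s => integral_nonneg fun x => hF0 N _ x
    calc ENNReal.ofReal δ ≤ ENNReal.ofReal (∫ s in Icc 0 t, ∫ x, F N ((Φ N).flow s z) x) :=
          ENNReal.ofReal_le_ofReal (le_of_lt hzδ)
      _ = ‖∫ s in Icc 0 t, ∫ x, F N ((Φ N).flow s z) x‖ₑ :=
          (Real.enorm_eq_ofReal (integral_nonneg fun s => hI0 s)).symm
      _ ≤ ∫⁻ s in Icc 0 t, ‖∫ x, F N ((Φ N).flow s z) x‖ₑ := enorm_integral_le_lintegral_enorm _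
      _ ≤ ∫⁻ s in Icc 0 t, G N ((Φ N).flow s z) := lintegral_mono fun s =>
          (enorm_integral_le_lintegral_enorm _).trans_eq
            (lintegral_congr fun x => Real.enorm_eq_ofReal (hF0 N _ x))
  have hlim : Tendsto (fun N : ℕ => P N ∅ + 1 * (ENNReal.ofReal t * ∫⁻ z, G N z ∂(P N)) / ENNReal.ofReal δ)
      atTop (𝓝 0) := by
    have h2 : Tendsto (fun N : ℕ => ∫⁻ z, G N z ∂(P N)) atTop (𝓝 0) :=
      KfunAConeConst.tendsto_lintegral_kinetic hθ hσ2 Φ hφc hφ0 hφM hφ1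
    have h3 := ENNReal.Tendsto.div_const (b := ENNReal.ofReal δ)
      (ENNReal.Tendsto.const_mul (a := ENNReal.ofReal t) h2 (Or.inr ENNReal.ofReal_ne_top)) (Or.inr hc)
    simp only [mul_zero, ENNReal.zero_div] at h3
    simpa only [measure_empty, zero_add, one_mul] using h3
  exact tendsto_of_tendsto_of_tendsto_of_le_of_le tendsto_const_nhds hlim (fun _ => zero_le) hbound

end ValueChiConeConst

/-! ## The registered stub -/

open ValueChiConeConst in
/-- **[Vχ0C] Registered stub `stub_valueChi_cone_const` (line `hemisphere-affine-slaving`, crux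
`CollisionalTransferLocality`, stmt-AtomisticToContinuum-9518): THE ENERGY VALUE FUNCTIONAL ON CONE-KERNEL BLOCK
FIELDS VANISHES AT GLOBAL EQUILIBRIUM, UNIFORMLY IN `τ ≤ t`.** Under the homogeneous local Gibbs law `(1, 0, θ)`, for
`σ < σ₀(θ) = min(σ_LLN, σ_ceiling, η₁, 1/2)` (`η₁ = min(η_Z, η_c/2)`), every flow family, `t > 0`, cone radius
`0 < r < 1/4` and scalar test `χ` smooth on `[0, t]`: `G_N {∃ τ ∈ [0, t], δ < |Rhs[b_r](0, χ)(τ) + Kfun[b_r](0, χ)(τ)|} → 0`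
(union bound over the dilute / slice-integral / energy / closure events; see the module docstring). [folklore] -/
theorem stub_valueChi_cone_const : ∀ θ : ℝ, 0 < θ → ∃ σ₀ : ℝ, 0 < σ₀ ∧ ∀ σ : ℝ, 0 < σ → σ < σ₀ → ∀ (Φ : Flows σ) (t : ℝ), 0 < t → ∀ (r : ℝ), 0 < r → r < 1 / 4 → ∀ (χ : ℝ → T3 → ℝ), Literature.Analysis.FunctionSpaces.Torus.IsSmoothSpaceTimeOn (Icc 0 t) χ → ∀ δ : ℝ, 0 < δ → Tendsto (fun N : ℕ => Literature.MathematicalPhysics.KineticTheory.localGibbsLaw σ (fun _ => 1) (fun _ => 0) (fun _ => θ) N (Φ N) {z | ∃ τ ∈ Icc 0 t, δ < |(Rhs σ Φ (fun (_ : ℕ) (y : T3) => Literature.MathematicalPhysics.KineticTheory.coneKernel r y 0) (fun (_ : ℝ) (_ : T3) => (0 : V3)) χ N z τ + Kfun σ Φ (fun (_ : ℕ) (y : T3) => Literature.MathematicalPhysics.KineticTheory.coneKernel r y 0) (fun (_ : ℝ) (_ : T3) => (0 : V3)) χ N z τ)|}) atTop (𝓝 0) := by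
  intro θ hθ
  -- constants of the equation of state; radii: cone LLN, mollified ceiling, `σ ≤ η₁`, `σ ≤ 1/2` (as in [R0C])
  obtain ⟨ηZ, hηZ, K, hK, hZK⟩ := stub_hsCompressibility_linear
  obtain ⟨ηc, hηc, hZc⟩ := hsCompressibility_continuousOn
  obtain ⟨η₁, hη₁0, hη₁Z, hη₁c⟩ : ∃ η₁ : ℝ, 0 < η₁ ∧ η₁ ≤ ηZ ∧ η₁ ≤ ηc / 2 :=
    ⟨min ηZ (ηc / 2), lt_min hηZ (half_pos hηc), min_le_left _ _, min_le_right _ _⟩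
  obtain ⟨σL, hσL, HL⟩ := stub_coneLLNConst
  obtain ⟨σS, hσS, HS⟩ := stub_mollifiedCeilingConst θ hθ
  refine ⟨min (min σL σS) (min η₁ (1 / 2)), lt_min (lt_min hσL hσS) (lt_min hη₁0 (by norm_num)), ?_⟩
  intro σ hσ hlt Φ t ht r hr hr4 χ hχ δ hδ
  obtain ⟨⟨hltL, hltS⟩, hση, hlt2⟩ : (σ < σL ∧ σ < σS) ∧ σ < η₁ ∧ σ < 1 / 2 := by
    simpa only [lt_min_iff] using hlt
  have hhalf : σ ≤ 1 / 2 := hlt2.le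
  have hσ3 : σ ^ 3 ≤ η₁ / 4 := by
    have h2 : σ ^ 2 ≤ 1 / 4 := by nlinarith
    nlinarith [show σ ^ 3 = σ * σ ^ 2 by ring]
  have hσZ : σ ^ 3 ≤ ηZ := by linarith
  have hcontZ : ContinuousAt hsCompressibility (σ ^ 3) :=
    hZc.continuousAt (Icc_mem_nhds (by positivity) (by linarith))
  have hZ' : ∀ η : ℝ, 0 ≤ η → η ≤ η₁ → |hsCompressibility η - 1| ≤ K * η := fun η h0 h1 =>
    hZK η h0 (h1.trans hη₁Z)
  -- the cone kernel family (continuous, `0 ≤ · ≤ 3/(π r³)`, mass one), the zero vector test, the laws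
  set φ : ℕ → T3 → ℝ := fun (_ : ℕ) (y : T3) => coneKernel r y 0
  set ψ₀ : ℝ → T3 → V3 := fun (_ : ℝ) (_ : T3) => (0 : V3)
  have hφc : ∀ N, Continuous (φ N) := fun _ => ConeLLNConst.continuous_coneKernel_zero r
  have hφ0 : ∀ N y, 0 ≤ φ N y := fun _ y => (coneKernel_mem_Icc hr y 0).1
  have hφM : ∀ N y, φ N y ≤ 3 / (Real.pi * r ^ 3) := fun _ y => (coneKernel_mem_Icc hr y 0).2
  have hφ1 : ∀ N, ∫ y, φ N y = 1 := fun _ => integral_coneKernel hr (by linarith) 0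
  have hψ₀ : Torus.IsSmoothSpaceTimeOn (Icc 0 t) ψ₀ := Torus.isSmoothSpaceTimeOn_const (Torus.isSmooth_const _) _
  have hdiv0 : ∀ s y, divPsi ψ₀ s y = 0 := ChannelAdditivity.divPsi_zero
  have hdiv_c : ∀ s, Continuous fun y => divPsi ψ₀ s y := fun s =>
    continuous_const.congr fun y => (hdiv0 s y).symm
  have hdiv_i : ∀ s, ∫ y, divPsi ψ₀ s y = 0 := fun s => by simp only [hdiv0, integral_zero]
  have hP : ∀ N, IsProbabilityMeasure (localGibbsLaw σ (fun _ => 1) (fun _ => 0) (fun _ => θ) N (Φ N)) :=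
    fun N => isProbabilityMeasure_localGibbsLaw continuous_const continuous_const continuous_const
      (fun _ => one_pos) (fun _ => hθ) hhalf N (Φ N)
  -- the dilute event `{∃ s ≤ t, ∃ x, η₁ < ρ̄σ³}` lies inside the mollified-ceiling event `{ρ_r > 2}` (`2σ³ ≤ η₁`)
  have hDil : Tendsto (fun N : ℕ => localGibbsLaw σ (fun _ => 1) (fun _ => 0) (fun _ => θ) N (Φ N)
      {z | ∃ s ∈ Icc 0 t, ∃ x : T3, η₁ < rhoB φ N ((Φ N).flow s z) x * σ ^ 3}) atTop (𝓝 0) := by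
    refine tendsto_of_tendsto_of_tendsto_of_le_of_le tendsto_const_nhds (HS σ hσ hltS Φ t r ht hr hr4)
      (fun N => zero_le) fun N => measure_mono ?_
    rintro z ⟨s, hs, x, hx⟩
    refine ⟨s, hs, x, ?_⟩
    have hρ : rhoB φ N ((Φ N).flow s z) x = mollDensity r ((Φ N).flow s z) x := ConeValue.rhoB_cone r N _ x
    rw [hρ] at hx
    by_contra hle
    have h := mul_le_mul_of_nonneg_right (not_lt.1 hle) (pow_nonneg hσ.le 3)
    linarith
  /- (1) THE RHS PART — adapted from the proof of `stub_rhsSup_of_constLLN` (module …RhsSupOfConstLLN) at the zero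
  vector test (`div ψ₀ = 0`): the cut-off slice process `X` with `G_N {δ/2 < |∫₀ᵗ X_s ds|} → 0`. -/
  have hpm : ∀ s, (projIcc 0 t ht.le s : ℝ) ∈ Icc 0 t := fun s => (projIcc 0 t ht.le s).2
  have hpI : ∀ {s}, s ∈ Icc 0 t → (projIcc 0 t ht.le s : ℝ) = s := fun hs => by
    rw [projIcc_of_mem ht.le hs]
  obtain ⟨C₃, hC₃0, hC₃ψ, hC₃χ⟩ := exists_grad_bound ht hψ₀ hχ
  have hgχ_b : ∀ {s}, s ∈ Icc 0 t → ∀ y a, |gradChi χ s y a| ≤ 3 * C₃ := fun hs y a =>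
    (hC₃χ _ hs y a).trans (by linarith)
  have hdiv_b : ∀ s y, |divPsi ψ₀ s y| ≤ 3 * C₃ := fun s y => by rw [hdiv0, abs_zero]; positivity
  obtain ⟨g₂, hg₂⟩ : ∃ g₂ : ℝ × T3 → V3, ∀ q, g₂ q = gradChi χ (projIcc 0 t ht.le q.1) q.2 :=
    ⟨_, fun _ => rfl⟩
  have hg₂c : Continuous g₂ := by
    rw [show g₂ = _ from funext hg₂]
    simpa only [gradChi] using continuous_comp_projIcc ht (hχ.gradient (uniqueDiffOn_Icc ht))
  -- the slice functional `Y` (through the clamped weight) and the dilute set `S`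
  obtain ⟨Y, hY⟩ : ∃ Y : (N : ℕ) → ℝ → Cfg N → ℝ, ∀ N s w, Y N s w = ∫ x,
      ((0 : ℝ) + ∑ j, g₂ (s, x) j * uB φ N w x j) * pcoll σ (rhoB φ N w x) (thetaB φ N w x) :=
    ⟨_, fun _ _ _ => rfl⟩
  have hYeq : ∀ N s (w : Cfg N), Y N s w = ∫ x, eulerW ψ₀ χ φ N (projIcc 0 t ht.le s) w x *
      pcoll σ (rhoB φ N w x) (thetaB φ N w x) := fun N s w => by
    rw [hY]
    refine integral_congr_ae (ae_of_all _ fun x => ?_)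
    simp only [hg₂, eulerW, hdiv0]
  have hYm : ∀ N, Measurable (uncurry (Y N)) := fun N => by
    simpa only [hY, Function.uncurry_def] using
      measurable_integral_eulerIntegrand σ (hφc N) (g₁ := fun _ => (0 : ℝ)) continuous_const hg₂c
  set S : (N : ℕ) → Set (Cfg N) := fun N => {w | ∀ x, rhoB φ N w x * σ ^ 3 ≤ η₁} with hS
  have hSm : ∀ N, MeasurableSet (S N) := fun N => (isClosed_setOf_dilute (hφc N) σ η₁).measurableSet
  -- envelope and deterministic smallness on the slices
  set B : ℝ := 3 * C₃ * K * η₁ with hB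
  have hEnv : ∀ N s, ∀ w ∈ S N, |Y N s w| ≤ B * (2 * (((N : ℝ) + 1)⁻¹ * ∑ i : Fin (N + 1),
      ‖(w i).2‖ ^ 2) + ((N : ℝ) + 1)⁻¹ * ∑ i : Fin (N + 1), ‖(w i).2‖ ^ 4) := fun N s w hw => by
    rw [hYeq]
    exact abs_integral_eulerW_pcoll_le_velAvg σ K ηZ η₁ (3 * C₃) hσ hK hη₁0 hη₁Z (by positivity)
      hZK φ N (hφc N) (hφ0 N) (hφ1 N) ψ₀ χ _ (hdiv_b _) (hgχ_b (hpm s)) w hw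
  -- the process `X`: the slice functional along a measurable modification of the flow, cut off
  -- outside the dilute set
  choose F hFm hF using fun N => exists_measurable_flow Φ N
  have hgood : ∀ N, ∀ᵐ z ∂(localGibbsLaw σ (fun _ => 1) (fun _ => 0) (fun _ => θ) N (Φ N)),
      z ∈ (Φ N).good := fun N => ae_iff.2 (localGibbsLaw_compl_good' (Φ N))
  have hFae : ∀ N s, ∀ᵐ z ∂(localGibbsLaw σ (fun _ => 1) (fun _ => 0) (fun _ => θ) N (Φ N)),
      F N (s, z) = (Φ N).flow s z := fun N s => (hgood N).mono fun z hz => hF N s z hz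
  have hinv := fun N s => map_flow_localGibbsLaw_const σ 1 θ 0 N (Φ N) s
  obtain ⟨W, hW⟩ : ∃ W : (N : ℕ) → ℝ → Cfg N → ℝ, ∀ N s, W N s = fun w =>
      (S N).indicator (fun _ => (1 : ℝ)) w * Y N s w := ⟨_, fun _ _ => rfl⟩
  have hWm : ∀ N s, Measurable (W N s) := fun N s => by
    rw [hW]
    exact ((measurable_const.indicator (hSm N)).mul (hYm N).of_uncurry_left)
  have hWle : ∀ N s w, |W N s w| ≤ B * (2 * (((N : ℝ) + 1)⁻¹ * ∑ i : Fin (N + 1),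
      ‖(w i).2‖ ^ 2) + ((N : ℝ) + 1)⁻¹ * ∑ i : Fin (N + 1), ‖(w i).2‖ ^ 4) := fun N s w => by
    rw [hW]
    by_cases hw : w ∈ S N
    · simp only [Set.indicator_of_mem hw, one_mul]
      exact hEnv N s w hw
    · simp only [Set.indicator_of_notMem hw, zero_mul, abs_zero]
      have hB0 : 0 ≤ B := by positivity
      positivity
  obtain ⟨X, hX⟩ : ∃ X : (N : ℕ) → ℝ → Cfg N → ℝ, ∀ N s, X N s = fun z => |W N s (F N (s, z))| :=
    ⟨_, fun _ _ => rfl⟩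
  -- (i) joint measurability
  have hXm : ∀ N, Measurable (uncurry (X N)) := by
    intro N
    have h1 : Measurable fun q : ℝ × Cfg N => W N q.1 (F N q) := by
      have hWu : Measurable fun q : ℝ × Cfg N => W N q.1 q.2 := by
        have : (fun q : ℝ × Cfg N => W N q.1 q.2) = fun q =>
            (S N).indicator (fun _ => (1 : ℝ)) q.2 * Y N q.1 q.2 := by
          funext q; rw [hW]
        rw [this]
        exact ((measurable_const.indicator (hSm N)).comp measurable_snd).mul (hYm N)
      exact hWu.comp (measurable_fst.prodMk (hFm N))
    simpa only [hX, Function.uncurry_def] using h1.abs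
  -- (ii) square integrability and (iii) uniform second moments, by stationarity and the envelope
  have hEnv2 := fun N => envelope_memLp_and_sq_le hθ hhalf Φ N B
  have hWL2 : ∀ N s, MemLp (W N s) 2 (localGibbsLaw σ (fun _ => 1) (fun _ => 0) (fun _ => θ) N (Φ N)) :=
    fun N s => MemLp.of_le (hEnv2 N).1 (hWm N s).aestronglyMeasurable
      (ae_of_all _ fun w => by
        rw [Real.norm_eq_abs, Real.norm_eq_abs]
        exact (hWle N s w).trans (le_abs_self _))
  have hXL2 : ∀ N, ∀ s ∈ Icc 0 t, MemLp (X N s) 2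
      (localGibbsLaw σ (fun _ => 1) (fun _ => 0) (fun _ => θ) N (Φ N)) := fun N s _ => by
    rw [hX]
    exact (memLp_comp_of_map_eq ((Φ N).measurable_flow s) (hinv N s) (hFae N s) (hWL2 N s)).abs
  have hXC : ∀ N, ∀ s ∈ Icc 0 t, ∫ z, X N s z ^ 2
      ∂(localGibbsLaw σ (fun _ => 1) (fun _ => 0) (fun _ => θ) N (Φ N)) ≤
      2 * B ^ 2 * (4 * ∫ v, (‖v‖ ^ 2) ^ 2 ∂(gaussMeasure (0 : V3) θ) +
        ∫ v, (‖v‖ ^ 4) ^ 2 ∂(gaussMeasure (0 : V3) θ)) := fun N s _ => by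
    simp only [hX, sq_abs]
    rw [integral_sq_comp_eq ((Φ N).measurable_flow s) (hinv N s) (hFae N s) (hWm N s)]
    refine le_trans ?_ (hEnv2 N).2
    refine integral_mono_of_nonneg (ae_of_all _ fun w => sq_nonneg _) (hEnv2 N).1.integrable_sq
      (ae_of_all _ fun w => ?_)
    have h := hWle N s w
    exact sq_le_sq' (abs_le.1 h).1 (abs_le.1 h).2
  -- (iv) convergence in probability of each slice `s ∈ [0, t]`
  have hXlim : ∀ s ∈ Icc 0 t, ∀ η : ℝ, 0 < η → Tendsto (fun N : ℕ =>
      localGibbsLaw σ (fun _ => 1) (fun _ => 0) (fun _ => θ) N (Φ N) {z | η < |X N s z|})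
      atTop (𝓝 0) := by
    intro s hs η hη
    obtain ⟨ε', hε', Hε⟩ := abs_integral_eulerW_pcoll_le_of_lln θ σ K ηZ η₁ (3 * C₃) hθ hσ hK hη₁0
      hη₁Z hσZ (by positivity) hZK hcontZ (η / 2) (half_pos hη)
    have hstat := HL σ hσ hltL θ hθ Φ r hr hr4 ε' hε'
    refine tendsto_of_tendsto_of_tendsto_of_le_of_le tendsto_const_nhds hstat
      (fun N => zero_le) fun N => ?_
    have hsub : {w : Cfg N | η < |W N s w|} ⊆ {z | ε' < ∫ x, ((rhoB φ N z x - 1) ^ 2 +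
        ‖mB φ N z x‖ ^ 2 + (EB φ N z x - 3 / 2 * θ) ^ 2)} := by
      intro w hw
      simp only [mem_setOf_eq] at hw ⊢
      by_contra hle
      push Not at hle
      rw [hW] at hw
      by_cases hwS : w ∈ S N
      · simp only [Set.indicator_of_mem hwS, one_mul] at hw
        have h := Hε φ N (hφc N) (hφ0 N) ψ₀ χ s (hdiv_c s) (hdiv_b s) (hgχ_b hs) (hdiv_i s) w
          hwS hle
        rw [hYeq, hpI hs] at hw
        linarith
      · simp only [Set.indicator_of_notMem hwS, zero_mul, abs_zero] at hw
        linarith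
    calc localGibbsLaw σ (fun _ => 1) (fun _ => 0) (fun _ => θ) N (Φ N) {z | η < |X N s z|}
        = localGibbsLaw σ (fun _ => 1) (fun _ => 0) (fun _ => θ) N (Φ N)
            {z | η < |W N s (F N (s, z))|} := by simp only [hX, abs_abs]
      _ ≤ localGibbsLaw σ (fun _ => 1) (fun _ => 0) (fun _ => θ) N (Φ N) {w | η < |W N s w|} :=
          measure_event_comp_le ((Φ N).measurable_flow s) (hinv N s) (hFae N s) (W N s) η
      _ ≤ _ := measure_mono hsub
  -- the time-integral lemma on `[0, t]` at level `δ/2`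
  have hmain := tendsto_measure_setIntegral_of_forall
    (fun N => localGibbsLaw σ (fun _ => 1) (fun _ => 0) (fun _ => θ) N (Φ N)) hP ht.le X hXm hXL2
    hXC hXlim (δ / 2) (half_pos hδ)
  /- (2) THE KFUN PART: the energy cap [E], the constants `ε`, `δ'` chosen from `δ/2` (as in the proof of [C]°
  `stub_weightedKineticRelaxationDilute`), the closure event -/
  obtain ⟨E₀, -, hEcap⟩ := stub_energyAllTimes (fun _ => 1) (fun _ => θ) (fun _ => 0)
    ⟨continuous_const, continuous_const, continuous_const, fun _ => one_pos, fun _ => hθ⟩ σ hσ hhalf Φ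
  set Kc : ℝ := C₃ + 1 with hKc
  have hKc0 : 0 < Kc := by positivity
  set A₀ : ℝ := (12 * K * η₁ + 18 * K ^ 2 * σ ^ 3 * η₁ * |E₀|) * t + 1 with hA₀
  have hA₀0 : 0 < A₀ := by positivity
  set ε : ℝ := δ / 2 / (3 * Kc * A₀) with hε
  have hε0 : 0 < ε := by positivity
  set δ' : ℝ := δ / 2 * ε / (3 * Kc * (12 * K * η₁ + 9)) with hδ'
  have hδ'0 : 0 < δ' := by positivity
  have hCl := tendsto_measure_kineticClosure hθ hhalf Φ hφc hφ0 hφM hφ1 t hδ'0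
  /- (3) the union bound: off the dilute / slice-integral / energy / closure events, on good data with integrable
  paths, `sup_τ |Rhs| ≤ ∫₀ᵗ X ≤ δ/2` and `sup_τ |Kfun| ≤ δ/3` -/
  have hlim : Tendsto (fun N : ℕ =>
      localGibbsLaw σ (fun _ => 1) (fun _ => 0) (fun _ => θ) N (Φ N)
          {z | ∃ s ∈ Icc 0 t, ∃ x : T3, η₁ < rhoB φ N ((Φ N).flow s z) x * σ ^ 3} +
        localGibbsLaw σ (fun _ => 1) (fun _ => 0) (fun _ => θ) N (Φ N)
          {z | δ / 2 < |∫ s in Icc 0 t, X N s z|} +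
        (localGibbsLaw σ (fun _ => 1) (fun _ => 0) (fun _ => θ) N (Φ N)
            {z | ∃ s ∈ Icc 0 t, E₀ < ((N : ℝ) + 1)⁻¹ * configEnergy ((Φ N).flow s z)} +
          localGibbsLaw σ (fun _ => 1) (fun _ => 0) (fun _ => θ) N (Φ N)
            {z | δ' < ∫ s in Icc 0 t, ∫ x, ((∑ j, ∑ k, Dst φ N ((Φ N).flow s z) x j k ^ 2) +
              ‖qfl φ N ((Φ N).flow s z) x‖ ^ 2)})) atTop (𝓝 0) := by
    simpa only [add_zero] using (hDil.add hmain).add ((hEcap t).add hCl)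
  refine tendsto_of_tendsto_of_tendsto_of_le_of_le tendsto_const_nhds hlim (fun N => zero_le) fun N => ?_
  haveI := hP N
  refine (measure_mono_ae ?_).trans ((measure_union_le _ _).trans
    (add_le_add (measure_union_le _ _) (measure_union_le _ _)))
  filter_upwards [hgood N, ae_integrableOn_Icc_of_sq_le _ (hXm N) (hXL2 N) (hXC N)] with z hz hzi
  rintro ⟨τ, hτ, hτδ⟩
  by_contra hnot
  change z ∉ ((_ : Set (Cfg N)) ∪ _) ∪ (_ ∪ _) at hnot
  simp only [Set.mem_union, not_or, Set.mem_setOf_eq, not_exists, not_and, not_lt] at hnot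
  obtain ⟨⟨hBd, hA⟩, hen, hcl⟩ := hnot
  -- Kfun: the pathwise bound of [C]° with the energy cap and the closure level, `|Kfun τ| ≤ δ/3`
  have hKf := abs_Kfun_dilute_le Φ hz (hφc N) (hφ0 N) (hφ1 N) (hφM N) hσ hK hη₁0.le hε0 hC₃0 hZ' hC₃ψ hC₃χ
    hBd hτ
  have hEz : ((N + 1 : ℕ) : ℝ)⁻¹ * configEnergy z ≤ |E₀| := by
    have h := hen 0 ⟨le_rfl, ht.le⟩
    rw [configEnergy_orbit Φ hz 0] at h
    rw [Nat.cast_succ]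
    exact h.trans (le_abs_self E₀)
  set e := ((N + 1 : ℕ) : ℝ)⁻¹ * configEnergy z with he
  set I := ∫ s in Icc 0 t, ∫ x, ((∑ j, ∑ k, Dst φ N ((Φ N).flow s z) x j k ^ 2) +
    ‖qfl φ N ((Φ N).flow s z) x‖ ^ 2) with hI
  have hI0 : 0 ≤ I := integral_nonneg fun s => integral_nonneg fun x => by positivity
  have he0 : 0 ≤ e := mul_nonneg (by positivity) (by unfold configEnergy; positivity)
  have hKK : C₃ ≤ Kc := by rw [hKc]; linarith
  have h18 : (0 : ℝ) ≤ 18 * K ^ 2 * σ ^ 3 * η₁ := by positivity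
  have hin : 12 * K * η₁ + 18 * K ^ 2 * σ ^ 3 * η₁ * e ≤ 12 * K * η₁ + 18 * K ^ 2 * σ ^ 3 * η₁ * |E₀| :=
    by linarith [mul_le_mul_of_nonneg_left hEz h18]
  have hA₀le : (12 * K * η₁ + 18 * K ^ 2 * σ ^ 3 * η₁ * |E₀|) * t ≤ A₀ := by rw [hA₀]; linarith
  have hKε : 0 ≤ Kc * ε := mul_nonneg hKc0.le hε0.le
  have hSt0 : 0 ≤ (12 * K * η₁ + 18 * K ^ 2 * σ ^ 3 * η₁ * e) * t := by positivity
  have hX9 : 0 ≤ (12 * K * η₁ + 9) / ε := by positivity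
  have h1K : (C₃ * (12 * K * η₁ * ε) + C₃ * (18 * ε * K ^ 2 * σ ^ 3 * η₁) * e) * t ≤ δ / 2 / 3 := by
    calc (C₃ * (12 * K * η₁ * ε) + C₃ * (18 * ε * K ^ 2 * σ ^ 3 * η₁) * e) * t
        = C₃ * ε * ((12 * K * η₁ + 18 * K ^ 2 * σ ^ 3 * η₁ * e) * t) := by ring
      _ ≤ Kc * ε * ((12 * K * η₁ + 18 * K ^ 2 * σ ^ 3 * η₁ * |E₀|) * t) :=
          mul_le_mul (mul_le_mul_of_nonneg_right hKK hε0.le) (mul_le_mul_of_nonneg_right hin ht.le) hSt0 hKε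
      _ ≤ Kc * ε * A₀ := mul_le_mul_of_nonneg_left hA₀le hKε
      _ = δ / 2 / 3 := by rw [hε]; field_simp
  have h2K : C₃ * ((12 * K * η₁ + 9) / ε) * I ≤ δ / 2 / 3 := by
    calc C₃ * ((12 * K * η₁ + 9) / ε) * I ≤ Kc * ((12 * K * η₁ + 9) / ε) * δ' :=
          mul_le_mul (mul_le_mul_of_nonneg_right hKK hX9) hcl hI0 (mul_nonneg hKc0.le hX9)
      _ = δ / 2 / 3 := by rw [hδ']; field_simp
  -- Rhs: on `[0, τ]` the integrand of `Rhs` has absolute value `X`, so `|Rhs τ| ≤ ∫₀ᵗ X ≤ δ/2`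
  have hXnn : ∀ s, 0 ≤ X N s z := fun s => by rw [hX]; exact abs_nonneg _
  have hslice : ∀ s ∈ Icc 0 τ, |∫ x, eulerW ψ₀ χ φ N s ((Φ N).flow s z) x *
      pcoll σ (rhoB φ N ((Φ N).flow s z) x) (thetaB φ N ((Φ N).flow s z) x)| = X N s z := by
    intro s hs
    have hs' : s ∈ Icc 0 t := ⟨hs.1, hs.2.trans hτ.2⟩
    have hdilS : (Φ N).flow s z ∈ S N := fun x => hBd s hs' x
    simp only [hX, hW, hF N s z hz, Set.indicator_of_mem hdilS, one_mul]
    rw [hYeq, hpI hs']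
  have h1 : |Rhs σ Φ φ ψ₀ χ N z τ| ≤ ∫ s in Icc 0 τ, X N s z := by
    unfold Rhs
    rw [← Real.norm_eq_abs]
    refine (norm_integral_le_integral_norm _).trans (le_of_eq ?_)
    refine setIntegral_congr_fun measurableSet_Icc fun s hs => ?_
    rw [Real.norm_eq_abs]
    exact hslice s hs
  have h2 : ∫ s in Icc 0 τ, X N s z ≤ ∫ s in Icc 0 t, X N s z :=
    setIntegral_mono_set hzi (ae_of_all _ fun s => hXnn s) (Icc_subset_Icc_right hτ.2).eventuallyLE
  have hR : |Rhs σ Φ φ ψ₀ χ N z τ| ≤ δ / 2 := by linarith [(le_abs_self _).trans hA]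
  have hsum := abs_add_le (Rhs σ Φ φ ψ₀ χ N z τ) (Kfun σ Φ φ ψ₀ χ N z τ)
  linarith [hτδ.trans_le hsum]

end

end Summit.AtomisticToContinuum.HydrodynamicLimit.Theorems.HemisphereAffineSlaving
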